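import Mathlib.Algebra.MvPolynomial.Equiv
import Mathlib.Algebra.Polynomial.Roots
import Mathlib.Topology.Algebra.MvPolynomial
import Mathlib.Analysis.SpecialFunctions.Complex.Log
import Mathlib.MeasureTheory.Constructions.Pi
import Mathlib.MeasureTheory.Measure.Lebesgue.Basic
import Mathlib.MeasureTheory.Measure.Prod
import Literature.MeasureTheory.Lebesgue.PolynomialZeroSet
import HarnessLib

/-!
# The zero set of a nonzero trigonometric polynomial is Lebesgue-null

Companion of `Literature/MeasureTheory/Lebesgue/PolynomialZeroSet.lean` (the zero set of a nonzero
REAL polynomial on `ℝᴺ` is Lebesgue-null).  Here the polynomial is a complex polynomial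
`P ∈ ℂ[z₁, …, z_N]` and it is evaluated on the torus, `z_j = e^{iθ_j}`: if `P ≠ 0` then
`{θ ∈ ℝᴺ | P(e^{iθ₁}, …, e^{iθ_N}) = 0}` has Lebesgue measure zero
(`MvPolynomial.volume_torusZeroSet_eq_zero`; general finite index type
`MvPolynomial.volume_torusZeroSet_eq_zero_of_fintype`; almost-everywhere form
`MvPolynomial.ae_eval_torusPt_ne_zero`; and `MvPolynomial.measure_torusZeroSet_eq_zero_of_ac` for
every measure absolutely continuous with respect to Lebesgue measure).  Every trigonometric
polynomial `∑ c_k e^{i k·θ}` (`k ∈ ℤᴺ`, finitely many `c_k ≠ 0`) is `e^{-i m·θ} P(e^{iθ})` for a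
genuine polynomial `P` and some `m ∈ ℕᴺ`, so this is the statement «a trigonometric polynomial that
does not vanish identically vanishes only on a null set».

The proof is the induction on the number of variables of Caron–Traynor (the tree's
`MvPolynomial.volume_zeroSet_eq_zero`, followed literally): `P` is a polynomial in `z₁` with
coefficients in `ℂ[z₂, …]` (`MvPolynomial.finSuccEquiv`); some coefficient `Q_k ≠ 0`, so by induction
`Q_k(e^{iθ'}) ≠ 0` for almost every `θ' ∈ ℝ^{N}`; for such `θ'` the section `{t | P(e^{it}, e^{iθ'}) = 0}`
is contained in the preimage under `t ↦ e^{it}` of the finite root set of a nonzero univariate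
polynomial, a countable set (`Complex.exp_eq_exp_iff_exists_int`), hence null; Tonelli
(`Measure.prod_apply_symm`) along `ℝ^{N+1} ≃ ℝ × ℝᴺ` (`volume_preserving_piFinSuccAbove`) concludes.
The one new ingredient relative to the real case is the base step
`Polynomial.volume_setOf_eval_exp_eq_zero`.

Used by `Literature/MathematicalPhysics/QuantumLattice/StaggeredDiracSingularSetNull.lean` (the
massless staggered Dirac operator of `U(N)` lattice gauge theory is invertible for Haar-almost every
gauge field: after a central rephasing of the links its determinant is a trigonometric polynomial
in the phases).

## References

* R. Caron, T. Traynor, *The zero set of a polynomial*, WSMR Report 05-02, Univ. of Windsor (2005)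
  (statement and induction for real polynomials; the torus case is the same argument).
* H. Federer, *Geometric Measure Theory*, Springer 1969, §2.6.2 (Fubini) — background.
-/

open MeasureTheory MvPolynomial

namespace MvPolynomial

/-- The point `(e^{iθ_j})_j` of the torus `(S¹)ᴺ ⊆ ℂᴺ` with angles `θ`. [cite: CaronTraynor2005, Theorem (p. 1)] -/
noncomputable def torusPt {σ : Type*} (θ : σ → ℝ) : σ → ℂ := fun j => Complex.exp (θ j * Complex.I)

/-- The coordinates of `torusPt θ`. [cite: CaronTraynor2005, Theorem (p. 1)] -/
theorem torusPt_apply {σ : Type*} (θ : σ → ℝ) (j : σ) :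
    torusPt θ j = Complex.exp (θ j * Complex.I) := rfl

/-- The points of the torus have unit modulus coordinates. [cite: CaronTraynor2005, Theorem (p. 1)] -/
theorem norm_torusPt_apply {σ : Type*} (θ : σ → ℝ) (j : σ) : ‖torusPt θ j‖ = 1 := by
  rw [torusPt_apply, Complex.norm_exp_ofReal_mul_I]

/-- The coordinates of a torus point are nonzero. [cite: CaronTraynor2005, Theorem (p. 1)] -/
theorem torusPt_apply_ne_zero {σ : Type*} (θ : σ → ℝ) (j : σ) : torusPt θ j ≠ 0 := by
  rw [torusPt_apply]; exact Complex.exp_ne_zero _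

/-- Reindexing the angles reindexes the torus point. [cite: CaronTraynor2005, Theorem (p. 1)] -/
theorem torusPt_comp {σ τ : Type*} (θ : σ → ℝ) (f : τ → σ) : torusPt (θ ∘ f) = torusPt θ ∘ f := rfl

/-- `torusPt` commutes with `Fin.cons`. [cite: CaronTraynor2005, Theorem (p. 1)] -/
theorem torusPt_cons {N : ℕ} (t : ℝ) (s : Fin N → ℝ) :
    torusPt (Fin.cons t s : Fin (N + 1) → ℝ) = Fin.cons (Complex.exp (t * Complex.I)) (torusPt s) := by
  funext j
  refine Fin.cases ?_ (fun i => ?_) j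
  · simp [torusPt]
  · simp [torusPt]

/-- The map `θ ↦ (e^{iθ_j})_j` is continuous. [cite: CaronTraynor2005, Theorem (p. 1)] -/
theorem continuous_torusPt {σ : Type*} : Continuous (torusPt : (σ → ℝ) → σ → ℂ) :=
  continuous_pi fun j =>
    Complex.continuous_exp.comp ((Complex.continuous_ofReal.comp (continuous_apply j)).mul continuous_const)

/-- The fibres of `t ↦ e^{it}` are countable (translates of `2πℤ`). [cite: CaronTraynor2005, Theorem (p. 1)] -/
theorem countable_setOf_exp_mul_I_eq (w : ℂ) : {t : ℝ | Complex.exp (t * Complex.I) = w}.Countable := by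
  by_cases h : ∃ t₀ : ℝ, Complex.exp (t₀ * Complex.I) = w
  · obtain ⟨t₀, ht₀⟩ := h
    refine (Set.countable_range fun n : ℤ => t₀ + n * (2 * Real.pi)).mono fun t ht => ?_
    simp only [Set.mem_setOf_eq] at ht
    rw [← ht₀, Complex.exp_eq_exp_iff_exists_int] at ht
    obtain ⟨n, hn⟩ := ht
    refine ⟨n, ?_⟩
    have h1 : ((t : ℂ) - (t₀ + n * (2 * Real.pi))) * Complex.I = 0 := by
      have := congrArg (fun z => z - (↑t₀ * Complex.I + ↑n * (2 * ↑Real.pi * Complex.I))) hn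
      simp only [sub_self] at this
      rw [← this]; ring
    have h2 : ((t : ℂ) - (t₀ + n * (2 * Real.pi))) = 0 := by
      rcases mul_eq_zero.1 h1 with h | h
      · exact h
      · exact absurd h Complex.I_ne_zero
    have h3 : (t : ℝ) = t₀ + n * (2 * Real.pi) := by
      have := congrArg Complex.re h2
      simpa [sub_eq_zero] using this
    exact h3.symm
  · have hempty : {t : ℝ | Complex.exp (t * Complex.I) = w} = ∅ := by
      ext t
      simp only [Set.mem_setOf_eq, Set.mem_empty_iff_false, iff_false]
      exact fun ht => h ⟨t, ht⟩
    rw [hempty]; exact Set.countable_empty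

/-- A nonzero univariate complex polynomial vanishes at `e^{it}` only for `t` in a countable, hence
Lebesgue-null, set of angles. [cite: CaronTraynor2005, Theorem (p. 1)] -/
theorem _root_.Polynomial.volume_setOf_eval_exp_eq_zero {Q : Polynomial ℂ} (hQ : Q ≠ 0) :
    volume {t : ℝ | Q.eval (Complex.exp (t * Complex.I)) = 0} = 0 := by
  classical
  have hcount : {t : ℝ | Q.eval (Complex.exp (t * Complex.I)) = 0}.Countable := by
    have hsub : {t : ℝ | Q.eval (Complex.exp (t * Complex.I)) = 0} ⊆
        ⋃ w ∈ Q.roots.toFinset, {t : ℝ | Complex.exp (t * Complex.I) = w} := by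
      intro t ht
      simp only [Set.mem_setOf_eq] at ht
      simp only [Set.mem_iUnion, Set.mem_setOf_eq, Multiset.mem_toFinset]
      exact ⟨_, (Polynomial.mem_roots hQ).2 ht, rfl⟩
    refine Set.Countable.mono hsub ?_
    exact Set.Countable.biUnion (Finset.countable_toSet _) fun w _ => countable_setOf_exp_mul_I_eq w
  exact hcount.measure_zero volume

/-- **The zero set of a nonzero complex polynomial in `N` variables on the torus is Lebesgue-null**:
`vol {θ ∈ ℝᴺ | P(e^{iθ₁}, …, e^{iθ_N}) = 0} = 0` (induction on `N` through `finSuccEquiv` and Tonelli,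
as in the real case). [cite: CaronTraynor2005, Theorem (p. 1)] -/
theorem volume_torusZeroSet_eq_zero : ∀ (N : ℕ) (P : MvPolynomial (Fin N) ℂ), P ≠ 0 →
    volume {θ : Fin N → ℝ | eval (torusPt θ) P = 0} = 0
  | 0, P, hP => by
    have hempty : {θ : Fin 0 → ℝ | eval (torusPt θ) P = 0} = ∅ := by
      ext θ
      simp only [Set.mem_setOf_eq, Set.mem_empty_iff_false, iff_false]
      rw [eval_eq_coeff_zero_of_isEmpty]
      intro h
      apply hP
      rw [MvPolynomial.eq_C_of_isEmpty P, h, C_0]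
    rw [hempty, measure_empty]
  | N + 1, P, hP => by
    classical
    -- `P` as a polynomial in the first variable with coefficients in the other `N`
    set q : Polynomial (MvPolynomial (Fin N) ℂ) := finSuccEquiv ℂ N P with hq
    have hq0 : q ≠ 0 := by
      rw [hq]
      exact (EmbeddingLike.map_ne_zero_iff (f := finSuccEquiv ℂ N)).2 hP
    obtain ⟨k, hk⟩ : ∃ k, q.coeff k ≠ 0 := by
      by_contra h
      push Not at h
      exact hq0 (Polynomial.ext fun k => by rw [h k, Polynomial.coeff_zero])
    -- induction hypothesis for the coefficient `q_k`
    have IH : volume {s : Fin N → ℝ | eval (torusPt s) (q.coeff k) = 0} = 0 :=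
      volume_torusZeroSet_eq_zero N (q.coeff k) hk
    -- the zero set and its image in `ℝ × ℝ^N`
    set Z : Set (Fin (N + 1) → ℝ) := {θ | eval (torusPt θ) P = 0} with hZ
    have hZm : MeasurableSet Z :=
      (isClosed_eq ((MvPolynomial.continuous_eval P).comp continuous_torusPt) continuous_const).measurableSet
    set e := MeasurableEquiv.piFinSuccAbove (fun _ : Fin (N + 1) => ℝ) 0 with he
    have hmp : MeasurePreserving e volume volume :=
      volume_preserving_piFinSuccAbove (fun _ : Fin (N + 1) => ℝ) 0
    have hS : MeasurableSet (e.symm ⁻¹' Z) := hZm.preimage e.symm.measurable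
    -- `vol Z = (vol × vol) (e.symm ⁻¹' Z)`
    have h1 : volume Z = volume (e.symm ⁻¹' Z) := by
      rw [← hmp.measure_preimage hS.nullMeasurableSet]
      congr 1
      ext x
      simp
    rw [h1, Measure.volume_eq_prod, Measure.prod_apply_symm hS]
    -- the `s`-indexed sections are root sets of univariate polynomials composed with `t ↦ e^{it}`
    have hsec : ∀ s : Fin N → ℝ, (fun t : ℝ => (t, s)) ⁻¹' (e.symm ⁻¹' Z) =
        {t : ℝ | (Polynomial.map (eval (torusPt s)) q).eval (Complex.exp (t * Complex.I)) = 0} := by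
      intro s
      ext t
      simp only [Set.mem_preimage, Set.mem_setOf_eq, hZ, he,
        MeasurableEquiv.piFinSuccAbove_symm_apply]
      change eval (torusPt (Fin.insertNth 0 t s)) P = 0 ↔ _
      rw [Fin.insertNth_zero', torusPt_cons, MvPolynomial.eval_eq_eval_mv_eval', ← hq]
    -- for almost every `s` the section polynomial is nonzero, hence has a null zero set
    have hae : (fun s : Fin N → ℝ => volume ((fun t : ℝ => (t, s)) ⁻¹' (e.symm ⁻¹' Z))) =ᵐ[volume]
        fun _ => 0 := by
      have hsub : {s : Fin N → ℝ | volume ((fun t : ℝ => (t, s)) ⁻¹' (e.symm ⁻¹' Z)) ≠ 0} ⊆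
          {s | eval (torusPt s) (q.coeff k) = 0} := by
        intro s hs
        by_contra hne
        apply hs
        rw [hsec s]
        apply Polynomial.volume_setOf_eval_exp_eq_zero
        intro hzero
        apply hne
        have := congrArg (fun R : Polynomial ℂ => R.coeff k) hzero
        simpa [Polynomial.coeff_map] using this
      exact measure_mono_null hsub IH
    rw [lintegral_congr_ae hae, lintegral_zero]

/-- **The zero set of a nonzero complex polynomial on the torus is Lebesgue-null**, for any finite
set of variables. [cite: CaronTraynor2005, Theorem (p. 1)] -/
theorem volume_torusZeroSet_eq_zero_of_fintype {σ : Type*} [Fintype σ] (P : MvPolynomial σ ℂ)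
    (hP : P ≠ 0) : volume {θ : σ → ℝ | eval (torusPt θ) P = 0} = 0 := by
  classical
  set N := Fintype.card σ
  set f : σ ≃ Fin N := Fintype.equivFin σ
  -- transport the polynomial to `Fin N` variables
  set P' : MvPolynomial (Fin N) ℂ := rename f P with hP'
  have hP'0 : P' ≠ 0 := by
    rw [hP']
    exact (MvPolynomial.rename_injective f f.injective).ne hP
  have h0 := volume_torusZeroSet_eq_zero N P' hP'0
  -- and the measure along `θ ↦ θ ∘ f.symm`
  have hmp : MeasurePreserving (MeasurableEquiv.piCongrLeft (fun _ : Fin N => ℝ) f) volume volume :=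
    volume_measurePreserving_piCongrLeft (fun _ : Fin N => ℝ) f
  have hZm : MeasurableSet {θ : Fin N → ℝ | eval (torusPt θ) P' = 0} :=
    (isClosed_eq ((MvPolynomial.continuous_eval P').comp continuous_torusPt) continuous_const).measurableSet
  have hpre : (MeasurableEquiv.piCongrLeft (fun _ : Fin N => ℝ) f) ⁻¹' {θ : Fin N → ℝ | eval (torusPt θ) P' = 0} =
      {θ : σ → ℝ | eval (torusPt θ) P = 0} := by
    ext θ
    simp only [Set.mem_preimage, Set.mem_setOf_eq, hP', eval_rename, ← torusPt_comp]
    suffices h : (⇑(MeasurableEquiv.piCongrLeft (fun _ : Fin N => ℝ) f) θ) ∘ f = θ by rw [h]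
    funext i
    simp [MeasurableEquiv.piCongrLeft, Equiv.piCongrLeft_apply_apply]
  rw [← hpre, hmp.measure_preimage hZm.nullMeasurableSet, h0]

/-- Almost-everywhere form: a nonzero complex polynomial is nonzero at `(e^{iθ_j})_j` for Lebesgue-almost
every `θ`. [cite: CaronTraynor2005, Theorem (p. 1)] -/
theorem ae_eval_torusPt_ne_zero {σ : Type*} [Fintype σ] (P : MvPolynomial σ ℂ) (hP : P ≠ 0) :
    ∀ᵐ θ : σ → ℝ ∂volume, eval (torusPt θ) P ≠ 0 := by
  rw [ae_iff]
  simpa using volume_torusZeroSet_eq_zero_of_fintype P hP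

/-- For every measure absolutely continuous with respect to Lebesgue measure (e.g. the uniform
probability on a box of angles) the torus zero set of a nonzero complex polynomial is null. [cite: CaronTraynor2005, Theorem (p. 1)] -/
theorem measure_torusZeroSet_eq_zero_of_ac {σ : Type*} [Fintype σ] {μ : Measure (σ → ℝ)}
    (hμ : μ ≪ volume) (P : MvPolynomial σ ℂ) (hP : P ≠ 0) :
    μ {θ : σ → ℝ | eval (torusPt θ) P = 0} = 0 :=
  hμ (volume_torusZeroSet_eq_zero_of_fintype P hP)

/-- A function of the angles of which a multiple is the torus evaluation of a nonzero complex
polynomial vanishes only on a Lebesgue-null set. [cite: CaronTraynor2005, Theorem (p. 1)] -/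
theorem volume_setOf_eq_zero_of_mul_eq_eval_torusPt {σ : Type*} [Fintype σ] (P : MvPolynomial σ ℂ)
    (hP : P ≠ 0) {f c : (σ → ℝ) → ℂ} (hf : ∀ θ, c θ * f θ = eval (torusPt θ) P) :
    volume {θ : σ → ℝ | f θ = 0} = 0 := by
  refine measure_mono_null (fun θ hθ => ?_) (volume_torusZeroSet_eq_zero_of_fintype P hP)
  simp only [Set.mem_setOf_eq] at hθ ⊢
  rw [← hf θ, hθ, mul_zero]

end MvPolynomial
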